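/-
LEAD seat `ym-line-cbag-p1` (prover-ym-line-cbag-p1-g5-0), route `ColdBoxAllGroups` (planner-of-record ym-idea-2): the rung leaf R2xi-G
`WeakCouplingRates.XiPow`, unconditionally, from the route's two proved cruxes (planner's ask 2026-08-28T01:15Z).
-/
import Summits.QuantumFields.YangMills.Theorems.ColdBoxAllGroupsBoxFloorAllGroups
import Summits.QuantumFields.YangMills.Theorems.ColdBoxAllGroupsBulkAllGroups

/-!
# The rung leaf R2xi-G `XiPow` — PROVED: `ξ(β) ≥ β^ε` for every compact simple gauge group

`xiPow_holds : WeakCouplingRates.XiPow`: for every compact simple `G` (tree sense `IsCompactSimpleLieGroup`) and every faithful unitary lattice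
representation `r` there is `ε > 0` such that every torus-limit state of the 4-D Wilson theory has RP-spectral mass gap `≤ β^{−ε}` for large `β`
(`MassGapPowerDecayOf 4 r.ρ ε`) — the route's deciding theorem `Theses.ColdBoxAllGroups.closes` applied to the two proved cruxes
`BoxFloorAllGroups_proof` (stmt-QuantumFields-22254, cold-box Gaussian floor, p585759) and `BulkAllGroups_proof` (stmt-QuantumFields-22255,
DLR bulk transfer, 2026-08-28).  The `SU(2)` instance `XiPowSU2` was already a tree theorem (`xiPowSU2_holds`).
This is a RECORD-label rung of LADDER-YM (Chatterjee's order-of-ξ question, power-rate form, beyond `SU(2)`); it is NOT the Clay Yang–Mills mass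
gap and no summit statement is proved by it.  No sorry; standard axioms.
-/

set_option autoImplicit false

namespace Summit.QuantumFields.YangMills.Theorems.WeakCouplingRates

/-- **Rung leaf R2xi-G `XiPow`, unconditionally** (all compact simple `G`, all faithful unitary lattice representations): the route
`ColdBoxAllGroups`'s deciding theorem applied to its two proved cruxes.  NOT the Clay mass gap (RECORD-label rung). -/
theorem xiPow_holds : XiPow :=
  Summit.QuantumFields.YangMills.Theses.ColdBoxAllGroups.closes
    Summit.QuantumFields.YangMills.Theorems.ColdBoxAllGroups.BoxFloorAllGroups_proof
    Summit.QuantumFields.YangMills.Theorems.ColdBoxAllGroups.BulkAllGroups_proof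

end Summit.QuantumFields.YangMills.Theorems.WeakCouplingRates
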